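import Summits.BirchSwinnertonDyer.BirchSwinnertonDyer.Theses.PrintCf2
import Summits.BirchSwinnertonDyer.BirchSwinnertonDyer.Theorems.PrintCf2RamifiedOffTYZLowerHalfTwoPrimesEvenOfFacts
import HarnessLib

/-!
# Route `PrintCf2`, aside stmt-BirchSwinnertonDyer-23358 `RamifiedLowerHalfTwoPrimesEvenOfFacts` — CLOSER BY NAME

The aside filed by planner g21 (route rev 50) under crux stmt-BirchSwinnertonDyer-20509 / item 23431 (C⁺): the LOWER HALF of C⁺ on the even
two-prime jump-one class `n = 2lq` (`l ≡ 1 (8)`, `q ≡ 3 (4)`, `(l/q) = 1`), from the named facts `tyz_cmPointRingClassFrobeniusValueData ∧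
thm11_parity_of_scriptL ∧ GZK`.  Proved BY NAME by the cycle-13 theorem of the crux LEAD (cruxlead-20509 g12, p735179).  CONDITIONAL on three named
facts without `_holds`; BSD is not proved by any of this; crux 20509 / item 23431 are NOT closed by this file.

References: [cite: TianYuanZhang2017, Thm. 1.1, §1 (p0002 L101–L110), §3 (Prop. 3.2 (2), Thm. 3.5, Thm. 3.6 (2), Lemma 3.18, proof of Lemma 3.21)];
[cite: Cox2013, §5.C Thm. 5.23, Cor. 5.25, §9.A]; [cite: HeathBrown1994SelmerCongruentII, §1, Appendix (Monsky)]; [cite: Darmon2004, Thm. 3.22].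
-/

set_option linter.dupNamespace false

namespace Summit.BirchSwinnertonDyer.BirchSwinnertonDyer.Theorems

/-- **Aside `RamifiedLowerHalfTwoPrimesEvenOfFacts` (stmt-BirchSwinnertonDyer-23358), by name**: the conjunction
`tyz_cmPointRingClassFrobeniusValueData ∧ thm11_parity_of_scriptL ∧ rank_eq_analyticRank_of_analyticRank_le_one` implies that for every square-free
`n = 2lq` (`l, q` prime, `l ≡ 1 (mod 8)`, `q ≡ 3 (mod 4)`, `(l/q) = 1`) with `ord_{s=1} L(E_n, s) = 1` and a generator `(x, y)` of `E_n(ℚ)` modulo torsion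
with `x ∉ {±1, ±2, ±n, ±2n}·ℚ^{×2}`, every `L` with `𝓛(n)² = L²` is even.
[cite: TianYuanZhang2017, Thm. 1.1 and §3 (Prop. 3.2 (2), Thm. 3.5, Thm. 3.6 (2), Lemma 3.18, proof of Lemma 3.21)] [cite: Cox2013, §5.C Cor. 5.25, §9.A] [cite: Darmon2004, Thm. 3.22] -/
theorem ramifiedLowerHalfTwoPrimesEvenOfFacts_proof :
    Summit.BirchSwinnertonDyer.BirchSwinnertonDyer.Theses.PrintCf2.RamifiedLowerHalfTwoPrimesEvenOfFacts := by
  unfold Summit.BirchSwinnertonDyer.BirchSwinnertonDyer.Theses.PrintCf2.RamifiedLowerHalfTwoPrimesEvenOfFacts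
  exact Summit.BirchSwinnertonDyer.PrintCf2.LowerHalfTwoPrimesEvenFacts.two_dvd_scriptL_two_primes_even_of_facts

end Summit.BirchSwinnertonDyer.BirchSwinnertonDyer.Theorems
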